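import Summits.AnomalousDissipation.AnomalousDissipation.Theorems.SawtoothPulseCascadeK1LocalisedCascadeExactChirp
import Mathlib.Analysis.PSeries

/-!
# K1loc, line `Spectral` / thin start — helper: SHARP LOW-PASS ENERGY OF THE EXACT ONE-TOOTH CHIRP (S-D start)

Helper file of the prover lane on the crux `K1LocalisedCascade` (stmt-AnomalousDissipation-19491), route `SawtoothPulseCascade`
(S-B/S-C assembly seat).  `…ExactChirp.sum_sq_norm_fourierCoeff_exactChirp_le` bounds `Σ_{|q|≤Q}‖ĝ₀(q)‖²` by the number of
terms times the largest term — adequate for cuts `Q ≤ |λ|/2` (aperture `2`) but a factor `≈ 2` off at the apertures `13/10`–`6/5`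
of the ledger's off-cone classes (`Q ≈ 0.8|λ|`).  Here the two-sideband bound `‖ĝ₀(q)‖ ≤ 1/(π|λ+q|) + 1/(π|λ−q|)` is SUMMED:
with `L = |λ|`, `Σ_{|q|≤Q}(1/(L+q) + 1/(L−q))² = Σ 1/(L+q)² + Σ 1/(L−q)² + (1/L)Σ(1/(L+q) + 1/(L−q))`, the inverse squares
telescope (`sum_Ioc_inv_sq_le_sub`) and the cross terms are at most `2/(L−Q)` each:
**`Σ_{|q|≤Q}‖ĝ₀(q)‖² ≤ (1/π²)(2/(L−Q−1) + (2Q+1)·2/(L(L−Q)))`** for `Q + 2 ≤ L` (`sum_sq_norm_fourierCoeff_exactChirp_le_sharp`).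
At aperture `a` (`Q ≈ L/a`): `≈ (2a + 4)/((a−1)π²L)` — `0.81/L` (`a = 2`), `2.2/L` (`a = 13/10`), `3/L` (`a = 6/5`).
No definitions; nothing about the crux. [cite: Grafakos2014, Prop. 3.1.2 (5)] [problem: turb]
-/

-- `Summit.<Summit>.<Problem>`: single-conjunct summit, the duplicate namespace segment is deliberate.
set_option linter.dupNamespace false

noncomputable section

namespace Summit.AnomalousDissipation.AnomalousDissipation.Theorems.SawtoothPulseCascade.K1Start

open MeasureTheory Set Filter Topology UnitAddTorus Function Complex AddCircle
open scoped Real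
open Literature.Analysis Literature.Analysis.FunctionSpaces Literature.Analysis.FunctionSpaces.Torus Literature.Analysis.FluidPDE
open Literature.Analysis.FluidPDE.SawtoothCascade

/-! ## §1 The real-variable sum -/

/-- **Telescoped inverse squares over a window**: for `Q + 2 ≤ L`,
`Σ_{t < 2Q+1} 1/(L − Q + t)² ≤ 1/(L − Q − 1)` (the terms are `1/j²`, `j = L−Q, …, L+Q`). [folklore] -/
theorem sum_range_inv_sq_shift_le {L Q : ℕ} (hQ : Q + 2 ≤ L) :
    ∑ t ∈ Finset.range (2 * Q + 1), 1 / (((L : ℝ) - Q + t) ^ 2) ≤ 1 / ((L : ℝ) - Q - 1) := by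
  have hf : ∀ t ∈ Finset.range (2 * Q + 1), 1 / (((L : ℝ) - Q + t) ^ 2) = (((L - Q + t : ℕ) : ℝ) ^ 2)⁻¹ := by
    intro t _
    rw [one_div, Nat.cast_add, Nat.cast_sub (show Q ≤ L by omega)]
  rw [Finset.sum_congr rfl hf]
  have hIco : ∑ t ∈ Finset.range (2 * Q + 1), (((L - Q + t : ℕ) : ℝ) ^ 2)⁻¹ =
      ∑ j ∈ Finset.Ico (L - Q) (L + Q + 1), ((j : ℝ) ^ 2)⁻¹ := by
    rw [Finset.sum_Ico_eq_sum_range, show L + Q + 1 - (L - Q) = 2 * Q + 1 by omega]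
  have hIoc : Finset.Ico (L - Q) (L + Q + 1) = Finset.Ioc (L - Q - 1) (L + Q) := by
    ext j
    rw [Finset.mem_Ico, Finset.mem_Ioc]
    omega
  rw [hIco, hIoc]
  calc ∑ j ∈ Finset.Ioc (L - Q - 1) (L + Q), ((j : ℝ) ^ 2)⁻¹ ≤ ((L - Q - 1 : ℕ) : ℝ)⁻¹ - ((L + Q : ℕ) : ℝ)⁻¹ :=
        sum_Ioc_inv_sq_le_sub (by omega) (by omega)
    _ ≤ 1 / ((L : ℝ) - Q - 1) := by
        have h1 : ((L - Q - 1 : ℕ) : ℝ) = (L : ℝ) - Q - 1 := by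
          rw [Nat.cast_sub (by omega), Nat.cast_sub (by omega)]; push_cast; ring
        rw [h1, one_div]
        have : (0 : ℝ) ≤ ((L + Q : ℕ) : ℝ)⁻¹ := by positivity
        linarith

/-- **The squared two-sideband sum**: for `Q + 2 ≤ L`,
`Σ_{t<2Q+1}(1/(L−Q+t) + 1/(L+Q−t))² ≤ 2/(L−Q−1) + (2Q+1)·(2/(L(L−Q)))`. [folklore] -/
theorem sum_sq_inv_add_inv_le {L Q : ℕ} (hQ : Q + 2 ≤ L) :
    ∑ t ∈ Finset.range (2 * Q + 1), (1 / ((L : ℝ) - Q + t) + 1 / ((L : ℝ) + Q - t)) ^ 2 ≤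
      2 / ((L : ℝ) - Q - 1) + (2 * Q + 1) * (2 / ((L : ℝ) * ((L : ℝ) - Q))) := by
  have hL : (Q : ℝ) + 2 ≤ L := by exact_mod_cast hQ
  have hQ0 : (0 : ℝ) ≤ Q := Nat.cast_nonneg Q
  -- termwise expansion and the cross-term bound
  have hterm : ∀ t ∈ Finset.range (2 * Q + 1), (1 / ((L : ℝ) - Q + t) + 1 / ((L : ℝ) + Q - t)) ^ 2 ≤
      1 / (((L : ℝ) - Q + t) ^ 2) + 1 / (((L : ℝ) + Q - t) ^ 2) + 2 / ((L : ℝ) * ((L : ℝ) - Q)) := by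
    intro t ht
    have ht' : (t : ℝ) ≤ 2 * Q := by
      have := Finset.mem_range.1 ht
      exact_mod_cast (by omega : t ≤ 2 * Q)
    have ht0 : (0 : ℝ) ≤ t := Nat.cast_nonneg t
    set x : ℝ := (L : ℝ) - Q + t with hx
    set y : ℝ := (L : ℝ) + Q - t with hy
    have hx0 : (L : ℝ) - Q ≤ x := by rw [hx]; linarith
    have hy0 : (L : ℝ) - Q ≤ y := by rw [hy]; linarith
    have hxp : 0 < x := by linarith
    have hyp : 0 < y := by linarith
    have hxy : x + y = 2 * L := by rw [hx, hy]; ring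
    -- `2/(xy) = (2/(x+y))(1/x + 1/y) = (1/L)(1/x+1/y) ≤ (1/L)(2/(L−Q))`
    have hprod : (L : ℝ) * ((L : ℝ) - Q) ≤ x * y := by
      rw [hx, hy]; nlinarith [sq_nonneg ((t : ℝ) - Q)]
    have hLQ : 0 < (L : ℝ) * ((L : ℝ) - Q) := by nlinarith
    have hcross : 2 * (1 / x) * (1 / y) ≤ 2 / ((L : ℝ) * ((L : ℝ) - Q)) := by
      rw [show 2 * (1 / x) * (1 / y) = 2 / (x * y) by field_simp]
      exact div_le_div_of_nonneg_left (by norm_num) hLQ hprod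
    calc (1 / x + 1 / y) ^ 2 = 1 / x ^ 2 + 1 / y ^ 2 + 2 * (1 / x) * (1 / y) := by ring
      _ ≤ 1 / x ^ 2 + 1 / y ^ 2 + 2 / ((L : ℝ) * ((L : ℝ) - Q)) := by linarith
  refine (Finset.sum_le_sum hterm).trans ?_
  rw [Finset.sum_add_distrib, Finset.sum_add_distrib, Finset.sum_const, Finset.card_range, nsmul_eq_mul]
  -- the two inverse-square sums
  have hA := sum_range_inv_sq_shift_le hQ
  have hB : ∑ t ∈ Finset.range (2 * Q + 1), 1 / (((L : ℝ) + Q - t) ^ 2) ≤ 1 / ((L : ℝ) - Q - 1) := by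
    have hrefl : ∑ t ∈ Finset.range (2 * Q + 1), 1 / (((L : ℝ) + Q - t) ^ 2) =
        ∑ t ∈ Finset.range (2 * Q + 1), 1 / (((L : ℝ) - Q + t) ^ 2) := by
      rw [← Finset.sum_range_reflect (fun t => 1 / (((L : ℝ) - Q + t) ^ 2)) (2 * Q + 1)]
      refine Finset.sum_congr rfl fun t ht => ?_
      have ht' := Finset.mem_range.1 ht
      have hc : ((2 * Q + 1 - 1 - t : ℕ) : ℝ) = 2 * Q - t := by
        rw [Nat.cast_sub (by omega), Nat.cast_sub (by omega)]; push_cast; ring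
      rw [hc]
      congr 2
      ring
    rw [hrefl]; exact hA
  push_cast
  have h2 : 1 / ((L : ℝ) - Q - 1) + 1 / ((L : ℝ) - Q - 1) = 2 / ((L : ℝ) - Q - 1) := by ring
  linarith [hA, hB, h2]

/-! ## §2 The sharp low-pass energy -/

/-- **Sharp low-pass energy of the exact one-tooth chirp**: for `λ ∈ ℤ`, `L = |λ|`, `Q + 2 ≤ L`,
`Σ_{q=−Q}^{Q}‖ĝ₀(q)‖² ≤ (1/π²)·(2/(L−Q−1) + (2Q+1)·2/(L(L−Q)))`. [cite: Grafakos2014, Prop. 3.1.2 (5)] -/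
theorem sum_sq_norm_fourierCoeff_exactChirp_le_sharp {lam : ℤ} {g₀ : UnitAddCircle → ℂ}
    (hg₀ : ∀ t : ℝ, g₀ (t : UnitAddCircle) = Complex.exp (-(2 * π * I * lam * ((tri (2 * π * t) / (2 * π) : ℝ) : ℂ))))
    (hg₀c : Continuous g₀) {Q : ℕ} (hQ : Q + 2 ≤ lam.natAbs) :
    ∑ q ∈ Finset.Icc (-(Q : ℤ)) Q, ‖fourierCoeff g₀ q‖ ^ 2 ≤
      1 / π ^ 2 * (2 / ((lam.natAbs : ℝ) - Q - 1) + (2 * Q + 1) * (2 / ((lam.natAbs : ℝ) * ((lam.natAbs : ℝ) - Q)))) := by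
  classical
  have hπ : 0 < π := Real.pi_pos
  set L : ℕ := lam.natAbs with hL
  have hLr : (L : ℝ) = |(lam : ℝ)| := by rw [hL, Nat.cast_natAbs, Int.cast_abs]
  have hQL : (Q : ℝ) + 2 ≤ L := by exact_mod_cast hQ
  -- termwise bound by the two sidebands, written with `L = |λ|`
  have hterm : ∀ q ∈ Finset.Icc (-(Q : ℤ)) Q, ‖fourierCoeff g₀ q‖ ^ 2 ≤
      1 / π ^ 2 * (1 / ((L : ℝ) - Q + ((q + Q : ℤ) : ℝ)) + 1 / ((L : ℝ) + Q - ((q + Q : ℤ) : ℝ))) ^ 2 := by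
    intro q hq
    rw [Finset.mem_Icc] at hq
    have hq1 : q ≠ -lam := by intro h; subst h; simp [hL] at hQ; omega
    have hq2 : q ≠ lam := by intro h; subst h; simp [hL] at hQ; omega
    have hb := norm_fourierCoeff_exactChirp_le hg₀ hg₀c hq1 hq2
    have hqr : -(Q : ℝ) ≤ q ∧ (q : ℝ) ≤ Q := ⟨by exact_mod_cast hq.1, by exact_mod_cast hq.2⟩
    -- `{|λ+q|, |λ−q|} = {L+q, L−q}`
    have hpair : 1 / (π * |((lam + q : ℤ) : ℝ)|) + 1 / (π * |((lam - q : ℤ) : ℝ)|) =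
        1 / π * (1 / ((L : ℝ) - Q + ((q + Q : ℤ) : ℝ)) + 1 / ((L : ℝ) + Q - ((q + Q : ℤ) : ℝ))) := by
      push_cast
      have e1 : (L : ℝ) - Q + (q + Q) = L + q := by ring
      have e2 : (L : ℝ) + Q - (q + Q) = L - q := by ring
      rw [e1, e2, hLr]
      have hQL' : (Q : ℝ) + 2 ≤ |(lam : ℝ)| := hLr ▸ hQL
      rcases le_or_gt 0 (lam : ℝ) with hl | hl
      · have hLv : |(lam : ℝ)| = lam := abs_of_nonneg hl
        rw [hLv] at hQL'
        have h1 : (lam : ℝ) + q ≠ 0 := by linarith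
        have h2 : (lam : ℝ) - q ≠ 0 := by linarith
        rw [hLv, abs_of_pos (by linarith), abs_of_pos (by linarith)]
        field_simp
      · have hLv : |(lam : ℝ)| = -lam := abs_of_neg hl
        rw [hLv] at hQL'
        have h1 : (lam : ℝ) + q ≠ 0 := by linarith
        have h2 : (lam : ℝ) - q ≠ 0 := by linarith
        have h3 : -(lam : ℝ) + q ≠ 0 := by linarith
        have h4 : -(lam : ℝ) - q ≠ 0 := by linarith
        rw [hLv, abs_of_neg (by linarith), abs_of_neg (by linarith)]
        field_simp
        ring
    rw [hpair] at hb
    have h0 : 0 ≤ ‖fourierCoeff g₀ q‖ := norm_nonneg _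
    calc ‖fourierCoeff g₀ q‖ ^ 2 ≤ (1 / π * (1 / ((L : ℝ) - Q + ((q + Q : ℤ) : ℝ)) + 1 / ((L : ℝ) + Q - ((q + Q : ℤ) : ℝ)))) ^ 2 :=
          pow_le_pow_left₀ h0 hb 2
      _ = _ := by rw [mul_pow]; ring
  refine (Finset.sum_le_sum hterm).trans ?_
  rw [← Finset.mul_sum]
  refine mul_le_mul_of_nonneg_left ?_ (by positivity)
  -- reindex `q = t − Q`, `t ∈ range (2Q+1)`
  have hmap : Finset.Icc (-(Q : ℤ)) Q = (Finset.range (2 * Q + 1)).map ⟨fun t : ℕ => (t : ℤ) - Q, fun a b h => by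
      simpa using h⟩ := by
    ext q
    simp only [Finset.mem_Icc, Finset.mem_map, Finset.mem_range, Function.Embedding.coeFn_mk]
    constructor
    · rintro ⟨h1, h2⟩; exact ⟨(q + Q).toNat, by omega, by omega⟩
    · rintro ⟨t, ht, rfl⟩; omega
  rw [hmap, Finset.sum_map]
  simp only [Function.Embedding.coeFn_mk]
  have hcast : ∀ t : ℕ, (((t : ℤ) - Q + Q : ℤ) : ℝ) = (t : ℝ) := fun t => by push_cast; ring
  simp_rw [hcast]
  exact sum_sq_inv_add_inv_le hQ

end Summit.AnomalousDissipation.AnomalousDissipation.Theorems.SawtoothPulseCascade.K1Start
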